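import Literature.MathematicalPhysics.QuantumFieldTheory.Balaban1983to89.B13GreenPrimeSymLettersOfReg335
import Literature.MathematicalPhysics.QuantumFieldTheory.Balaban1983to89.B9Thm37CubeCoverCommutatorSizes

/-!
# `Balaban1983to89.B13SiteReadingNumerals` — T. Bałaban, *Renormalization group approach to lattice gauge field theories. II. Cluster expansions*,
# Commun. Math. Phys. **116** (1988) 1–22 [Balaban1988RG2Cluster], (2.5)–(2.7) pp. 12–13 (the random-walk expansion on the unit lattice `T₁^{(k)}` of the
# k-th step), p. 15; *Propagators for lattice gauge theories in a background field*, Commun. Math. Phys. **99** (1985) 389–434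
# [Balaban1985BackgroundPropagators], (3.3) p. 390, (3.19) p. 393, (3.24) p. 394, Thm 3.1 (3.42) p. 397, Thm 3.10 (3.107)–(3.108) p. 416; *Propagators and
# renormalization transformations for lattice gauge theories. II*, Commun. Math. Phys. **96** (1984) 223–250 [Balaban1984PropagatorsII], (2.1) p. 224 (the torus
# `T_η` and its fundamental box), (2.46) p. 231 (the `ℓ¹` lattice distance): THE READINGS OF NODE 00's SITES INTO [13]'s SITE TORUS AND THEIR NUMERALS —
# the reading ∕ averaging binders `ℓ, s, κ, m, D, Cavg` displayed by the N10 pencil junctions (modules 76 ∕ 78 ∕ 79 of the N10 lane) TURNED INTO NUMBERS at two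
# LOCATED INSTANCES of the reading, and the located shape fact that the multiplicative rate binder penalises the unit-block reading by `L^k`.

THE BINDERS.  The N10 junctions read an operator's kernel decay on NODE 00's box chart `SiteY i = Π_μ[0, N₀_μ)` (`N₀ = L^k·L·M_h·P`, [II] (2.1)) through a READING
`ℓ : SiteY i → UT Nf` into the site torus of [13]'s term tower, with displayed numerals: a step bound `s` (`d₁(ℓ(z+e_μ), ℓ z) ≤ s` and `d₁(ℓ z, ℓ w) ≤ s` for
averaging partners `w` of `z`), a rate comparison `κ` (`κ·d₁(ℓ z, ℓ w) ≤ |z − w|_T∕L^k`, module 79 `…_of_reg335_reading`), a fibre bound `m` of `ℓ × basis`, and NODE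
00's averaging numerals `D` (steps from `z` through its block corner to an averaging partner) and `Cavg` (`Σ_w |a(z,w)| ≤ Cavg`).  The N10 lane's census
(`N10-RESIDUAL-CENSUS-v17.md`, item 4) asks for a located instance turning these into numbers.

WHAT THIS FILE PROVES (kernel-checked; 2 `def`s = the two readings, everything else `theorem`; nothing of NODE 00's ∕ N06's ∕ the lane's files is modified).
* §1 [folklore] block ∕ chart arithmetic (`abs_sub_lt_of_ediv_eq`, `min_val_sub_le_natAbs`, `tdist_boxEquiv_symm_le`: the `ℓ¹` torus distance of two charted
  sites is at most the `ℓ¹` distance of their box labels, `abs_sub_le_of_avgCoeffY_ne_zero`, `abs_sub_cornerY_le`) and ★ `hD_avgCoeffY` — THE AVERAGING-RANGE BINDER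
  `hD` OF 76 ∕ 78 ∕ 79 DISCHARGED WITH THE NUMBER `D = 2·(d+1)·(L^k − 1)`; the companion binder `hCavg` is the tree's `sum_abs_avgCoeffY_le_one` (`Cavg = 1`), cited by name in §4.
* §2 ★ the FINE reading `fineReadingY i hNf : SiteY i → UT Nf` for any period vector with `N₀_μ = Nf_μ` (at the record `Nf ≡ sitesPerDir 0` by `i.hN`): a box
  label vector IS a torus site.  `tdist1_fineReadingY_eq` (`d₁ = Σ_μ dist(z_μ − w_μ, N₀_μℤ)`), ★ `tdist1_fineReadingY_le_mul_torusSupNorm` (`d₁ ≤ (d+1)·|z − w|_T`),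
  ★★ `hκ_fineReadingY` — 79's RATE BINDER WITH **`κ = 1∕((d+1)·L^k)`**; `tdist1_fineReadingY_shiftY_le_one`, ★ `hℓ_fineReadingY` ∕ `hℓa_fineReadingY` — THE STEP
  AND AVERAGING-PARTNER BINDERS WITH **`s = (d+1)·L^k`**; `fineReadingY_injective`, ★ `hfib_fineReadingY` — THE FIBRE BINDER WITH **`m = #κ`** (`N²` at matrix units).
* §3 ★ the BLOCK reading `blockReadingY i hNf : SiteY i → UT Nf`, `z ↦ (⌊z_μ∕L^k⌋)_μ`, for any period vector with `N₀_μ = L^k·Nf_μ` (at the record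
  `Nf_μ = L·M_h·P_μ` by `N0`; [13]'s unit lattice of the k-th step).  `blockReadingY_eq_of_avgCoeffY_ne_zero` (averaging partners share the unit block — the
  `L^{lev}`-blocks nest, `ediv_pow_eq_ediv_ediv`) ⇒ ★ `hℓa_blockReadingY` with ANY `s ≥ 0`; ★ `hℓ_blockReadingY` with **`s = 1`**; ★ `hfib_blockReadingY` with
  **`m = (L^k)^{d+1}·#κ`**; ★★ `hκ_blockReadingY_affine` — the rate comparison is AFFINE: **`(1∕(d+1))·d₁(ℓ_blk z, ℓ_blk w) ≤ |z − w|_T∕L^k + 1`** (per coordinate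
  `L^k·dist_{ℤ∕n}(⌊z∕L^k⌋, ⌊w∕L^k⌋) ≤ dist_{ℤ∕L^k n}(z, w) + (L^k − 1)`, `mul_circAbs_ediv_sub_ediv_le`, through the centring translation of `B4TorusKernel`); and the
  LOCATED shape fact ★★ `blockReadingY_rate_le_inv_of_mul`: ANY `κ` satisfying 79's MULTIPLICATIVE binder for the block reading has **`κ ≤ 1∕L^k`** (witness: the two
  neighbours across a face of the first unit block, `d₁ = 1 = |z − w|_T`) — through that binder the block reading carries only the rate `δ₀∕L^k` per unit block,
  through the affine one `δ₀∕(d+1)` at the cost of the factor `e^{δ₀}` in the size letter.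
* §4 ★★ `norm_GpY_parSymY_single_le_of_reg335_affineReading` — 79 §1 (Theorem 3.1's kernel decay of `G′ = (Δ′_a)⁻¹` on the (3.35) class, n06-w1's tree theorem)
  through an AFFINE reading: `‖(G′(U)(δ_x ⊗ E))(y)‖ ≤ e^{δ₀c₀}·16(L^k)²√N·‖E‖·e^{−δ₀κ·d₁(ℓ y, ℓ x)}`; ★★★ `rawEntryLetters_toMatrix_GpY_parSymY_prodCfg_of_reg335_fineReading_record`
  — 79 §2 at the record's matrix units AND THE FINE READING with NO reading ∕ averaging numeral displayed (remaining: `η`, the thin radius `Rc > 0`, the target rate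
  `ρ′ < δ₀∕((d+1)L^k)`, the (3.35) data `c, α₀, G`); ★★★ `rawEntryLetters_toMatrix_GpY_parSymY_prodCfg_of_reg335_blockReading` — module 78's pencil junction fed
  with N06's tree theorems through the block reading and the affine lemma: the G′-factor's N10 letters ON THE UNIT TORUS with rate `ρ′ < δ₀∕(d+1)` per unit
  block, size letter `2·e^{δ₀}·16(L^k)²√N`, again with no reading ∕ averaging numeral displayed.

HONEST FRAMING: LOCATED INSTANCES and [folklore] integer ∕ torus arithmetic composed with cited tree theorems; the two readings are inhabited maps on NODE 00's
finite box, so 76 ∕ 78 ∕ 79's reading ∕ averaging binders are exhibited JOINTLY satisfiable with explicit numbers — they are NOT thereby chosen for the record: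
WHICH reading, which `Nf` and which letter family the N10 term tower of record uses is NODE 00's ∕ def-T's word (census item 3).  n06-w1's declared scope
carries over verbatim (one finite lattice operator at fixed `k`; the `(L^k)²` volume prefactor; a single-scale rate `δ₀∕L^k` per lattice step, i.e. `δ₀` per
unit block, not print's multi-scale `d(y,y′)`); §3's located fact concerns the SHAPE of the displayed rate binder only.  Nothing of Bałaban's is asserted
beyond the cited theorems; the bond-sector `G = Δ_a⁻¹` and `X⁻¹` are not touched; N06 ∕ N10 NOT discharged; K1⁷ NOT closed; counts unmoved (typed 28∕28 ·
discharged 5∕27); 0 `sorry`, standard axioms; no `instance`, no notation; one finite 𝕋⁴ programme at fixed ε — R4 closes the conditional finite-𝕋⁴ rung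
`BalabanLadder.UV` only; the YM mass gap (Clay) is NOT proved by any of this; nothing continuum ∕ ℝ⁴ ∕ OS.

WHY THIS FILE (cell `pub-ymgap`, HUMAN RULING D-0062 ∕ D-0149, Track A node N10 = [B13]; width seat `pub-ymgap-dag-n10-w6` g3, self-located R455 (A) claim on the
N10 lane's census v17 «What would move N10 next» item 4; key K1⁷ stmt-QuantumFields-20542, count-neutral helper).

References: T. Bałaban, CMP 116 (1988) 1–22 [Balaban1988RG2Cluster] (2.5)–(2.7) pp.12–13, p.15; CMP 99 (1985) 389–434 [Balaban1985BackgroundPropagators] (3.3) p.390,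
(3.19) p.393, (3.24)–(3.25) p.394, (3.35) p.396, Thm 3.1 (3.42) p.397, Thm 3.4 p.400, (3.60)–(3.65) p.402, Thm 3.10 (3.107)–(3.108) p.416; CMP 96 (1984) 223–250
[Balaban1984PropagatorsII] (2.1) p.224, (2.46) p.231, Lemma 2.1 (2.61) p.234; CMP 95 (1984) 17–40 [Balaban1984PropagatorsI] (1.6) p.18, (1.18) p.20; S. Agmon,
*Lectures on exponential decay* (1982) [Agmon1982] Ch. 1.
-/

noncomputable section

namespace Literature.MathematicalPhysics.QuantumFieldTheory.Balaban1983to89.B13SiteReadingNumerals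

open Finset
open Literature.MathematicalPhysics.QuantumFieldTheory.Balaban1983to89
open Node00 B6KLevelCensusIndexV1 B6GlobalChartV1
open Literature.MathematicalPhysics.QuantumFieldTheory.Balaban1983to89.B4Reflection242 (blk avgK boxDom mem_boxDom)
open Literature.MathematicalPhysics.QuantumFieldTheory.Balaban1983to89.B6MultiLevelBoxOperator (N0)
open Literature.MathematicalPhysics.QuantumFieldTheory.Balaban1983to89.B6MultiLevelTorusOperator (tshift tshift_val twrap unitVec)
open Literature.MathematicalPhysics.QuantumFieldTheory.Balaban1983to89.B4TorusKernel.MultiPeriod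
  (circAbs circAbs_nonneg circAbs_le_abs circAbs_add_mul circAbs_of_centred abs_add_mul_centre torusSupNorm)
open Literature.MathematicalPhysics.QuantumFieldTheory.Balaban1983to89.B4Sect5Torus (TSite ccoord ccoord_cast)
open Literature.MathematicalPhysics.QuantumFieldTheory.Balaban1983to89.B5TorusCover (UT)
open Literature.MathematicalPhysics.QuantumFieldTheory.Balaban1983to89.B9Thm37GlueTorus (tdist1 tdist1_nonneg tdist1_comm)

variable {d ℓ : ℕ} {hd : 1 ≤ d + 1} {hL : Odd (ℓ + 1) ∧ 1 < ℓ + 1} {b₀ b₁ : ℝ}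

/-! ## §1. [folklore] block and chart arithmetic; the averaging-range numeral `D` -/

section Arithmetic

/-- two integers with the same quotient by `b > 0` differ by less than `b`. [folklore] -/
private theorem abs_sub_lt_of_ediv_eq {b x y : ℤ} (hb : 0 < b) (h : x / b = y / b) : |x - y| < b := by
  have hx := Int.emod_def x b
  have hy := Int.emod_def y b
  have hx0 := Int.emod_nonneg x hb.ne'
  have hy0 := Int.emod_nonneg y hb.ne'
  have hx1 := Int.emod_lt_of_pos x hb
  have hy1 := Int.emod_lt_of_pos y hb
  rw [h] at hx
  rw [abs_sub_lt_iff]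
  constructor <;> linarith

/-- `0 ≤ x − b·(x / b) < b` (the offset of an integer from the corner of its `b`-block). [folklore] -/
private theorem sub_mul_ediv_bounds {b : ℤ} (hb : 0 < b) (x : ℤ) : 0 ≤ x - b * (x / b) ∧ x - b * (x / b) < b := by
  have hx := Int.emod_def x b
  have hx0 := Int.emod_nonneg x hb.ne'
  have hx1 := Int.emod_lt_of_pos x hb
  constructor <;> linarith

/-- the circular distance of two labels of `ℤ∕nℤ` is at most the distance of the labels. [folklore] -/
private theorem min_val_sub_le_natAbs {n : ℕ} [NeZero n] (a c : ZMod n) :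
    min (a - c).val (c - a).val ≤ Int.natAbs ((a.val : ℤ) - (c.val : ℤ)) := by
  rcases le_total c.val a.val with h | h
  · rw [ZMod.val_sub h]
    refine (min_le_left _ _).trans ?_
    omega
  · rw [ZMod.val_sub h]
    refine (min_le_right _ _).trans ?_
    omega

/-- the `ℓ¹` torus distance of two sites is at most the `ℓ¹` distance of their label vectors. [cite: Balaban1984PropagatorsII, (2.46) p.231 (the `ℓ¹` lattice distance), bookkeeping] -/
theorem tdist_le_sum_natAbs {P : Params} {j : ℕ} (x y : Site P j) :
    Site.tdist x y ≤ ∑ μ, Int.natAbs ((((x μ).val : ℕ) : ℤ) - (((y μ).val : ℕ) : ℤ)) :=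
  Finset.sum_le_sum fun μ _ => min_val_sub_le_natAbs (x μ) (y μ)

variable (i : KIdx d ℓ hd hL b₀ b₁)

/-- through NODE 00's box chart: the `ℓ¹` torus distance of two charted sites is at most the `ℓ¹` distance of their box labels.
[cite: Balaban1984PropagatorsII, (2.1) p.224 (the box chart), bookkeeping] -/
theorem tdist_boxEquiv_symm_le (z w : SiteY i) :
    (Site.tdist ((boxEquiv i.hN).symm z) ((boxEquiv i.hN).symm w) : ℤ) ≤ ∑ μ, |z.1 μ - w.1 μ| := by
  have h := tdist_le_sum_natAbs ((boxEquiv i.hN).symm z) ((boxEquiv i.hN).symm w)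
  have h' : (Site.tdist ((boxEquiv i.hN).symm z) ((boxEquiv i.hN).symm w) : ℤ) ≤
      ∑ μ, ((Int.natAbs ((((((boxEquiv i.hN).symm z) μ).val : ℕ) : ℤ) - (((((boxEquiv i.hN).symm w) μ).val : ℕ) : ℤ)) : ℕ) : ℤ) := by
    exact_mod_cast h
  refine h'.trans (le_of_eq (Finset.sum_congr rfl fun μ _ => ?_))
  rw [Int.natCast_natAbs, val_boxEquiv_symm, val_boxEquiv_symm]

/-- `L^{lev z} ≤ L^k` (the level of a site is at most `k`, `TDomains.lev_le`). [cite: Balaban1984PropagatorsII, (2.1)–(2.4) p.224, bookkeeping] -/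
theorem pow_levY_le (z : SiteY i) : (ℓ + 1) ^ levY i z ≤ (ℓ + 1) ^ i.k :=
  Nat.pow_le_pow_right (Nat.succ_pos ℓ) ((toKT i).D.lev_le z.1)

/-- an averaging partner lies in the same `L^{lev z}`-block: `⌊w_μ∕L^{lev z}⌋ = ⌊z_μ∕L^{lev z}⌋`.
[cite: Balaban1985BackgroundPropagators, (3.24) p.394 (block averaging), bookkeeping] -/
theorem blk_eq_of_avgCoeffY_ne_zero {z w : SiteY i} (h : avgCoeffY i z w ≠ 0) :
    blk ((ℓ + 1) ^ levY i z) w.1 = blk ((ℓ + 1) ^ levY i z) z.1 := by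
  unfold avgCoeffY avgK at h
  by_contra hne
  exact h (if_neg hne)

/-- … hence its labels differ from those of `z` by at most `L^{lev z} − 1 ≤ L^k − 1`.
[cite: Balaban1985BackgroundPropagators, (3.24) p.394, bookkeeping] -/
theorem abs_sub_le_of_avgCoeffY_ne_zero {z w : SiteY i} (h : avgCoeffY i z w ≠ 0) (μ : Fin (d + 1)) :
    |z.1 μ - w.1 μ| ≤ (((ℓ + 1) ^ i.k : ℕ) : ℤ) - 1 := by
  have hb : (0 : ℤ) < (((ℓ + 1) ^ levY i z : ℕ) : ℤ) := by positivity
  have hq := congrFun (blk_eq_of_avgCoeffY_ne_zero i h) μ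
  simp only [blk] at hq
  have hlt := abs_sub_lt_of_ediv_eq hb hq.symm
  have hle : (((ℓ + 1) ^ levY i z : ℕ) : ℤ) ≤ (((ℓ + 1) ^ i.k : ℕ) : ℤ) := by exact_mod_cast pow_levY_le i z
  omega

/-- a site is within `L^{j} − 1` of the corner of its `L^j`-block, coordinatewise.
[cite: Balaban1985BackgroundPropagators, (3.19) p.393 (the block's reference point), bookkeeping] -/
theorem abs_sub_cornerY_le (j : ℕ) (z : SiteY i) (μ : Fin (d + 1)) :
    |z.1 μ - (cornerY i j z).1 μ| ≤ (((ℓ + 1) ^ j : ℕ) : ℤ) - 1 := by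
  have hb : (0 : ℤ) < (((ℓ + 1) ^ j : ℕ) : ℤ) := by positivity
  rw [cornerY_apply]
  obtain ⟨h0, h1⟩ := sub_mul_ediv_bounds hb (z.1 μ)
  simp only [blk]
  rw [abs_of_nonneg h0]
  omega

/-- ★ **THE AVERAGING-RANGE BINDER `hD` OF THE PENCIL JUNCTIONS, DISCHARGED**: an averaging partner `w` of `z` is reached from `z` through the
block corner in at most `D = 2·(d+1)·(L^k − 1)` lattice steps (`ℓ¹` torus distance through NODE 00's box chart).
[cite: Balaban1985BackgroundPropagators, (3.19) p.393, (3.24) p.394; Balaban1984PropagatorsII, (2.1) p.224] -/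
theorem hD_avgCoeffY (z w : SiteY i) (h : avgCoeffY i z w ≠ 0) :
    Site.tdist ((boxEquiv i.hN).symm z) ((boxEquiv i.hN).symm (cornerY i (levY i z) z)) +
      Site.tdist ((boxEquiv i.hN).symm (cornerY i (levY i z) z)) ((boxEquiv i.hN).symm w) ≤
        2 * (d + 1) * ((ℓ + 1) ^ i.k - 1) := by
  have hk1 : 1 ≤ (ℓ + 1) ^ i.k := Nat.one_le_pow _ _ (Nat.succ_pos ℓ)
  have hcw : cornerY i (levY i z) z = cornerY i (levY i w) w :=
    (B9Thm311DeltaPrimeSymm.cornerY_eq_of_avgCoeffY_ne_zero i h).symm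
  have h1 := tdist_boxEquiv_symm_le i z (cornerY i (levY i z) z)
  have h2 := tdist_boxEquiv_symm_le i (cornerY i (levY i z) z) w
  have hz : (((ℓ + 1) ^ levY i z : ℕ) : ℤ) ≤ (((ℓ + 1) ^ i.k : ℕ) : ℤ) := by exact_mod_cast pow_levY_le i z
  have hw : (((ℓ + 1) ^ levY i w : ℕ) : ℤ) ≤ (((ℓ + 1) ^ i.k : ℕ) : ℤ) := by exact_mod_cast pow_levY_le i w
  have b1 : ∑ μ : Fin (d + 1), |z.1 μ - (cornerY i (levY i z) z).1 μ| ≤ ∑ _μ : Fin (d + 1), ((((ℓ + 1) ^ i.k : ℕ) : ℤ) - 1) :=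
    Finset.sum_le_sum fun μ _ => (abs_sub_cornerY_le i _ z μ).trans (by linarith)
  have b2 : ∑ μ : Fin (d + 1), |(cornerY i (levY i z) z).1 μ - w.1 μ| ≤ ∑ _μ : Fin (d + 1), ((((ℓ + 1) ^ i.k : ℕ) : ℤ) - 1) :=
    Finset.sum_le_sum fun μ _ => by
      rw [abs_sub_comm, hcw]
      exact (abs_sub_cornerY_le i _ w μ).trans (by linarith)
  rw [Finset.sum_const, Finset.card_univ, Fintype.card_fin, nsmul_eq_mul] at b1 b2
  have key : ((Site.tdist ((boxEquiv i.hN).symm z) ((boxEquiv i.hN).symm (cornerY i (levY i z) z)) : ℕ) : ℤ) +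
      ((Site.tdist ((boxEquiv i.hN).symm (cornerY i (levY i z) z)) ((boxEquiv i.hN).symm w) : ℕ) : ℤ) ≤
        2 * (((d + 1 : ℕ) : ℤ) * ((((ℓ + 1) ^ i.k : ℕ) : ℤ) - 1)) := by
    linarith
  have hcast : (((2 * (d + 1) * ((ℓ + 1) ^ i.k - 1) : ℕ) : ℤ)) = 2 * (((d + 1 : ℕ) : ℤ) * ((((ℓ + 1) ^ i.k : ℕ) : ℤ) - 1)) := by
    rw [Nat.cast_mul, Nat.cast_mul, Nat.cast_sub hk1, mul_assoc]
    norm_num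
  have := key.trans_eq hcast.symm
  exact_mod_cast this

end Arithmetic

/-! ## §2. The FINE reading: NODE 00's box labels as sites of a torus with the same periods -/

section Fine

variable (i : KIdx d ℓ hd hL b₀ b₁)
variable {Nf : Fin (d + 1) → ℕ}

/-- the unit vector has entries `0`, `1`: `|e_μ(ν)| = e_μ(ν)`. [folklore] -/
private theorem abs_unitVec (μ ν : Fin (d + 1)) : |unitVec μ ν| = unitVec μ ν := by
  unfold unitVec
  by_cases h : ν = μ
  · subst h; simp
  · simp [Pi.single_eq_of_ne h]

/-- `Σ_ν e_μ(ν) = 1`. [folklore] -/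
private theorem sum_unitVec (μ : Fin (d + 1)) : ∑ ν, unitVec μ ν = 1 := by
  unfold unitVec
  rw [Finset.sum_pi_single']
  simp

/-- ★ **THE FINE READING** `ℓ_fine : SiteY i → UT Nf` of NODE 00's box chart into [13]'s site torus WITH THE SAME PERIODS (`Nf_μ = N₀_μ`, displayed as
`hNf` so that the consumer's period vector carries its own `NeZero` instance — at the record `Nf ≡ sitesPerDir 0` by `i.hN`): a box label vector IS a
torus site. [cite: Balaban1988RG2Cluster, (2.5) p.12 (the unit torus of the k-th step), p.15; Balaban1984PropagatorsII, (2.1) p.224 (the box chart), dictionary] -/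
def fineReadingY (hNf : ∀ μ, (toKT i).NB μ = Nf μ) (z : SiteY i) : UT Nf :=
  UT.ofSite Nf fun μ => ⟨(z.1 μ).toNat, by
    obtain ⟨h0, h1⟩ := (mem_boxDom.1 z.2) μ
    have h2 : ((toKT i).NB μ : ℤ) = (Nf μ : ℤ) := by exact_mod_cast hNf μ
    omega⟩

/-- the labels of the read site are the box labels. [cite: Balaban1984PropagatorsII, (2.1) p.224, bookkeeping] -/
theorem fineReadingY_val (hNf : ∀ μ, (toKT i).NB μ = Nf μ) (z : SiteY i) (μ : Fin (d + 1)) :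
    (((UT.toSite Nf (fineReadingY i hNf z) μ).val : ℕ) : ℤ) = z.1 μ :=
  Int.toNat_of_nonneg ((mem_boxDom.1 z.2) μ).1

/-- the fine reading is injective (a site IS its labels). [cite: Balaban1984PropagatorsII, (2.1) p.224, bookkeeping] -/
theorem fineReadingY_injective (hNf : ∀ μ, (toKT i).NB μ = Nf μ) : Function.Injective (fineReadingY i hNf) := by
  intro z w h
  apply Subtype.ext
  funext μ
  have := congrArg (fun x : UT Nf => (((UT.toSite Nf x μ).val : ℕ) : ℤ)) h
  simpa only [fineReadingY_val] using this

/-- ★ **THE FIBRE BINDER `hfib` AT THE FINE READING with the number `m = #κ`** (the basis index; `N²` at matrix units): over each read site sit at most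
`#κ` product-basis indices. [cite: Balaban1985BackgroundPropagators, Thm 3.10 (3.107)–(3.108) p.416 (multiplicities), bookkeeping] -/
theorem hfib_fineReadingY {κ : Type} [Fintype κ] [DecidableEq κ] (hNf : ∀ μ, (toKT i).NB μ = Nf μ) (y : UT Nf) :
    (univ.filter fun p : SiteY i × κ => fineReadingY i hNf p.1 = y).card ≤ Fintype.card κ := by
  rw [← Finset.card_univ (α := κ)]
  refine Finset.card_le_card_of_injOn Prod.snd (fun _ _ => Finset.mem_coe.2 (Finset.mem_univ _)) ?_
  intro p hp q hq hpq
  rw [Finset.mem_coe, Finset.mem_filter] at hp hq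
  exact Prod.ext (fineReadingY_injective i hNf (hp.2.trans hq.2.symm)) hpq

variable [∀ μ, NeZero (Nf μ)]

/-- the coordinate distances of two read sites are the circular distances of the box labels. [cite: Balaban1984PropagatorsII, (2.46) p.231, bookkeeping] -/
theorem ccoord_fineReadingY (hNf : ∀ μ, (toKT i).NB μ = Nf μ) (z w : SiteY i) (μ : Fin (d + 1)) :
    ((ccoord Nf (UT.toSite Nf (fineReadingY i hNf z)) (UT.toSite Nf (fineReadingY i hNf w)) μ : ℕ) : ℤ) =
      circAbs (Nf μ) (z.1 μ - w.1 μ) := by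
  rw [ccoord_cast (UT.one_le Nf), fineReadingY_val, fineReadingY_val]

/-- the `ℓ¹` torus distance of two read sites, in box labels. [cite: Balaban1984PropagatorsII, (2.46) p.231, bookkeeping] -/
theorem tdist1_fineReadingY_eq (hNf : ∀ μ, (toKT i).NB μ = Nf μ) (z w : SiteY i) :
    tdist1 Nf (fineReadingY i hNf z) (fineReadingY i hNf w) = ∑ μ, ((circAbs (Nf μ) (z.1 μ - w.1 μ) : ℤ) : ℝ) := by
  unfold tdist1
  refine Finset.sum_congr rfl fun μ _ => ?_
  rw [← ccoord_fineReadingY i hNf z w μ, Int.cast_natCast]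

/-- the `ℓ¹` torus distance of two read sites is at most the `ℓ¹` distance of the labels. [cite: Balaban1984PropagatorsII, (2.46) p.231, bookkeeping] -/
theorem tdist1_fineReadingY_le_sum_abs (hNf : ∀ μ, (toKT i).NB μ = Nf μ) (z w : SiteY i) :
    tdist1 Nf (fineReadingY i hNf z) (fineReadingY i hNf w) ≤ ∑ μ, ((|z.1 μ - w.1 μ| : ℤ) : ℝ) := by
  rw [tdist1_fineReadingY_eq]
  exact Finset.sum_le_sum fun μ _ => by exact_mod_cast circAbs_le_abs (UT.one_le Nf μ) _

/-- ★ **`ℓ¹ ≤ (d+1)·ℓ^∞`**: the read distance is at most `(d+1)` times NODE 00's sup torus distance of the labels.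
[cite: Balaban1984PropagatorsII, (2.46) p.231; Balaban1985BackgroundPropagators, (3.42) p.397 (|x − y|), bookkeeping] -/
theorem tdist1_fineReadingY_le_mul_torusSupNorm (hNf : ∀ μ, (toKT i).NB μ = Nf μ) (z w : SiteY i) :
    tdist1 Nf (fineReadingY i hNf z) (fineReadingY i hNf w) ≤ (((d : ℝ) + 1)) * torusSupNorm (toKT i).NB (z.1 - w.1) := by
  rw [tdist1_fineReadingY_eq]
  have h : ∀ μ ∈ (univ : Finset (Fin (d + 1))), ((circAbs (Nf μ) (z.1 μ - w.1 μ) : ℤ) : ℝ) ≤ torusSupNorm (toKT i).NB (z.1 - w.1) := by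
    intro μ _
    have := Finset.le_sup' (fun j => ((circAbs ((toKT i).NB j) ((z.1 - w.1) j) : ℤ) : ℝ)) (Finset.mem_univ μ)
    rw [Pi.sub_apply, hNf μ] at this
    exact this
  calc ∑ μ, ((circAbs (Nf μ) (z.1 μ - w.1 μ) : ℤ) : ℝ) ≤ ∑ _μ : Fin (d + 1), torusSupNorm (toKT i).NB (z.1 - w.1) :=
        Finset.sum_le_sum h
    _ = ((d : ℝ) + 1) * torusSupNorm (toKT i).NB (z.1 - w.1) := by
        rw [Finset.sum_const, Finset.card_univ, Fintype.card_fin, nsmul_eq_mul]; push_cast; ring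

/-- ★★ **THE RATE BINDER `hκ` OF 79 AT THE FINE READING, WITH THE NUMBER `κ = 1∕((d+1)·L^k)`**: `κ·d₁(ℓ_fine z, ℓ_fine w) ≤ |z − w|_T∕L^k`.
[cite: Balaban1985BackgroundPropagators, Thm 3.1 (3.42) p.397; Balaban1988RG2Cluster, (2.5) p.12, p.15] -/
theorem hκ_fineReadingY (hNf : ∀ μ, (toKT i).NB μ = Nf μ) (z w : SiteY i) :
    (((d : ℝ) + 1) * ((((ℓ + 1) ^ i.k : ℕ) : ℝ)))⁻¹ * tdist1 Nf (fineReadingY i hNf z) (fineReadingY i hNf w) ≤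
      ((((ℓ + 1) ^ i.k : ℕ) : ℝ))⁻¹ * torusSupNorm (toKT i).NB (z.1 - w.1) := by
  have hLk : (0 : ℝ) < (((ℓ + 1) ^ i.k : ℕ) : ℝ) := by positivity
  have hd1 : (0 : ℝ) < (d : ℝ) + 1 := by positivity
  have h := tdist1_fineReadingY_le_mul_torusSupNorm i hNf z w
  calc (((d : ℝ) + 1) * ((((ℓ + 1) ^ i.k : ℕ) : ℝ)))⁻¹ * tdist1 Nf (fineReadingY i hNf z) (fineReadingY i hNf w)
      ≤ (((d : ℝ) + 1) * ((((ℓ + 1) ^ i.k : ℕ) : ℝ)))⁻¹ * ((((d : ℝ) + 1)) * torusSupNorm (toKT i).NB (z.1 - w.1)) :=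
        mul_le_mul_of_nonneg_left h (by positivity)
    _ = ((((ℓ + 1) ^ i.k : ℕ) : ℝ))⁻¹ * torusSupNorm (toKT i).NB (z.1 - w.1) := by
        field_simp

/-- a unit lattice step moves the fine reading by at most `1`. [cite: Balaban1985BackgroundPropagators, (3.3) p.390 (nearest neighbours), bookkeeping] -/
theorem tdist1_fineReadingY_shiftY_le_one (hNf : ∀ μ, (toKT i).NB μ = Nf μ) (μ : Fin (d + 1)) (z : SiteY i) :
    tdist1 Nf (fineReadingY i hNf (shiftY i μ z)) (fineReadingY i hNf z) ≤ 1 := by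
  rw [tdist1_fineReadingY_eq]
  have key : ∀ ν, circAbs (Nf ν) ((shiftY i μ z).1 ν - z.1 ν) = circAbs (Nf ν) (unitVec μ ν) := fun ν => by
    have hv : (shiftY i μ z).1 ν = (z.1 ν + unitVec μ ν) % ((toKT i).NB ν : ℤ) := by
      show (tshift (toKT i).NB (unitVec μ) z).1 ν = _
      rw [tshift_val]; rfl
    have hN : ((toKT i).NB ν : ℤ) = (Nf ν : ℤ) := by exact_mod_cast hNf ν
    rw [hv, Int.emod_def, hN]
    have : z.1 ν + unitVec μ ν - (Nf ν : ℤ) * ((z.1 ν + unitVec μ ν) / (Nf ν : ℤ)) - z.1 ν =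
        unitVec μ ν + (Nf ν : ℤ) * (-((z.1 ν + unitVec μ ν) / (Nf ν : ℤ))) := by ring
    rw [this, circAbs_add_mul]
  calc ∑ ν, ((circAbs (Nf ν) ((shiftY i μ z).1 ν - z.1 ν) : ℤ) : ℝ) = ∑ ν, ((circAbs (Nf ν) (unitVec μ ν) : ℤ) : ℝ) := by
        simp_rw [key]
    _ ≤ ∑ ν, ((unitVec μ ν : ℤ) : ℝ) := Finset.sum_le_sum fun ν _ => by
        have h := circAbs_le_abs (UT.one_le Nf ν) (unitVec μ ν)
        rw [abs_unitVec] at h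
        exact_mod_cast h
    _ = 1 := by rw [← Int.cast_sum, sum_unitVec]; simp

/-- an averaging partner is read within `(d+1)·(L^k − 1)` of the site. [cite: Balaban1985BackgroundPropagators, (3.24) p.394, bookkeeping] -/
theorem tdist1_fineReadingY_le_of_avgCoeffY_ne_zero (hNf : ∀ μ, (toKT i).NB μ = Nf μ) {z w : SiteY i} (h : avgCoeffY i z w ≠ 0) :
    tdist1 Nf (fineReadingY i hNf z) (fineReadingY i hNf w) ≤ ((d : ℝ) + 1) * (((((ℓ + 1) ^ i.k : ℕ) : ℝ)) - 1) := by
  refine (tdist1_fineReadingY_le_sum_abs i hNf z w).trans ?_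
  calc ∑ μ, ((|z.1 μ - w.1 μ| : ℤ) : ℝ) ≤ ∑ _μ : Fin (d + 1), ((((((ℓ + 1) ^ i.k : ℕ) : ℤ) - 1 : ℤ)) : ℝ) :=
        Finset.sum_le_sum fun μ _ => by exact_mod_cast abs_sub_le_of_avgCoeffY_ne_zero i h μ
    _ = ((d : ℝ) + 1) * (((((ℓ + 1) ^ i.k : ℕ) : ℝ)) - 1) := by
        rw [Finset.sum_const, Finset.card_univ, Fintype.card_fin, nsmul_eq_mul]; push_cast; ring

/-- ★ **THE STEP BINDER `hℓ` OF 76∕78∕79 AT THE FINE READING with the number `s = (d+1)·L^k`** (one lattice step costs `≤ 1 ≤ s`).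
[cite: Balaban1985BackgroundPropagators, (3.3) p.390, (3.107)–(3.108) p.416] -/
theorem hℓ_fineReadingY (hNf : ∀ μ, (toKT i).NB μ = Nf μ) (μ : Fin (d + 1)) (z : SiteY i) :
    tdist1 Nf (fineReadingY i hNf (shiftY i μ z)) (fineReadingY i hNf z) ≤ ((d : ℝ) + 1) * ((((ℓ + 1) ^ i.k : ℕ) : ℝ)) := by
  refine (tdist1_fineReadingY_shiftY_le_one i hNf μ z).trans ?_
  have h1 : (1 : ℝ) ≤ (((ℓ + 1) ^ i.k : ℕ) : ℝ) := by exact_mod_cast Nat.one_le_pow _ _ (Nat.succ_pos ℓ)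
  have h2 : (1 : ℝ) ≤ (d : ℝ) + 1 := by linarith [(Nat.cast_nonneg d : (0 : ℝ) ≤ d)]
  nlinarith

/-- ★ **THE AVERAGING-PARTNER BINDER `hℓa` OF 76∕78∕79 AT THE FINE READING with the same number `s = (d+1)·L^k`**.
[cite: Balaban1985BackgroundPropagators, (3.24) p.394, (3.107)–(3.108) p.416] -/
theorem hℓa_fineReadingY (hNf : ∀ μ, (toKT i).NB μ = Nf μ) (z w : SiteY i) (h : avgCoeffY i z w ≠ 0) :
    tdist1 Nf (fineReadingY i hNf z) (fineReadingY i hNf w) ≤ ((d : ℝ) + 1) * ((((ℓ + 1) ^ i.k : ℕ) : ℝ)) := by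
  refine (tdist1_fineReadingY_le_of_avgCoeffY_ne_zero i hNf h).trans ?_
  have h2 : (0 : ℝ) ≤ (d : ℝ) + 1 := by positivity
  nlinarith

end Fine

/-! ## §3. The BLOCK reading: box labels read in unit blocks (`⌊z_μ∕L^k⌋`), [13]'s unit lattice of the k-th step -/

section Block

variable (i : KIdx d ℓ hd hL b₀ b₁)
variable {Nf : Fin (d + 1) → ℕ}

/-- the offset from the block corner is at most the difference of the labels plus `b − 1`: `b·|⌊z∕b⌋ − ⌊w∕b⌋ + n·m| ≤ |z − w + (b·n)·m| + (b − 1)` for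
every integer `m` (the torus correction). [folklore] -/
private theorem mul_abs_ediv_sub_ediv_add_le {b : ℤ} (hb : 0 < b) (n m z w : ℤ) :
    b * |z / b - w / b + n * m| ≤ |z - w + b * n * m| + (b - 1) := by
  have hz := Int.emod_def z b
  have hw := Int.emod_def w b
  have hz0 := Int.emod_nonneg z hb.ne'
  have hw0 := Int.emod_nonneg w hb.ne'
  have hz1 := Int.emod_lt_of_pos z hb
  have hw1 := Int.emod_lt_of_pos w hb
  have e : b * (z / b - w / b + n * m) = (z - w + b * n * m) - (z % b - w % b) := by
    rw [hz, hw]; ring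
  rw [← abs_of_pos hb, ← abs_mul, abs_of_pos hb, e]
  refine (abs_sub _ _).trans ?_
  have : |z % b - w % b| ≤ b - 1 := by rw [abs_sub_le_iff]; constructor <;> linarith
  linarith

/-- ★ **ONE COORDINATE OF THE BLOCK READING AGAINST THE LABEL DISTANCE**: `b·dist_{ℤ∕n}(⌊z∕b⌋, ⌊w∕b⌋) ≤ dist_{ℤ∕bn}(z, w) + (b − 1)` — the circular distance of the
block labels (period `n`) is controlled by the circular distance of the labels (period `b·n`) up to the rounding `b − 1`.
[cite: Balaban1984PropagatorsI, (1.6) p.18, (1.18) p.20 (blocks of the torus); Balaban1984PropagatorsII, (2.46) p.231, bookkeeping] -/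
theorem mul_circAbs_ediv_sub_ediv_le {b n : ℕ} (hb : 1 ≤ b) (hn : 1 ≤ n) (z w : ℤ) :
    (b : ℤ) * circAbs n (z / b - w / b) ≤ circAbs (b * n) (z - w) + (b - 1) := by
  have hb0 : (0 : ℤ) < b := by exact_mod_cast hb
  have hbn : 1 ≤ b * n := Nat.one_le_iff_ne_zero.2 (Nat.mul_ne_zero_iff.2 ⟨by omega, by omega⟩)
  set m : ℤ := B4TorusKernel.MultiPeriod.centre (b * n) (z - w) with hm
  have hc : |z - w + ((b * n : ℕ) : ℤ) * m| = circAbs (b * n) (z - w) := abs_add_mul_centre hbn (z - w)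
  have h1 : circAbs n (z / b - w / b) = circAbs n (z / b - w / b + n * m) := (circAbs_add_mul n _ m).symm
  have h2 : circAbs n (z / b - w / b + n * m) ≤ |z / b - w / b + n * m| := circAbs_le_abs hn _
  have h3 := mul_abs_ediv_sub_ediv_add_le hb0 n m z w
  have h4 : (b : ℤ) * n * m = ((b * n : ℕ) : ℤ) * m := by push_cast; ring
  rw [h4, hc] at h3
  calc (b : ℤ) * circAbs n (z / b - w / b) = (b : ℤ) * circAbs n (z / b - w / b + n * m) := by rw [← h1]
    _ ≤ (b : ℤ) * |z / b - w / b + n * m| := mul_le_mul_of_nonneg_left h2 hb0.le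
    _ ≤ circAbs (b * n) (z - w) + (b - 1) := h3

/-- ★ **THE BLOCK READING** `ℓ_blk : SiteY i → UT Nf` of NODE 00's box chart into [13]'s UNIT torus of the k-th step: a site is read as the label vector
`⌊z_μ∕L^k⌋` of its unit block, for any period vector with `N₀_μ = L^k·Nf_μ` (at the record `Nf_μ = L·M_h·P_μ` by `N0`, displayed as `hNf` so that the
consumer's period vector carries its own `NeZero` instance). [cite: Balaban1988RG2Cluster, (2.5) p.12 («the unit lattice T₁^{(k)}»), p.15;
Balaban1984PropagatorsII, (2.1) p.224, dictionary] -/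
def blockReadingY (hNf : ∀ μ, (toKT i).NB μ = (ℓ + 1) ^ i.k * Nf μ) (z : SiteY i) : UT Nf :=
  UT.ofSite Nf fun μ => ⟨(z.1 μ / (((ℓ + 1) ^ i.k : ℕ) : ℤ)).toNat, by
    obtain ⟨h0, h1⟩ := (mem_boxDom.1 z.2) μ
    have hb : (0 : ℤ) < (((ℓ + 1) ^ i.k : ℕ) : ℤ) := by positivity
    have h2 : ((toKT i).NB μ : ℤ) = (((ℓ + 1) ^ i.k : ℕ) : ℤ) * (Nf μ : ℤ) := by exact_mod_cast hNf μ
    have h3 : z.1 μ / (((ℓ + 1) ^ i.k : ℕ) : ℤ) < Nf μ := by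
      rw [Int.ediv_lt_iff_lt_mul hb, mul_comm, ← h2]; exact h1
    have h4 : 0 ≤ z.1 μ / (((ℓ + 1) ^ i.k : ℕ) : ℤ) := Int.ediv_nonneg h0 hb.le
    omega⟩

/-- the labels of the block reading are the block labels `⌊z_μ∕L^k⌋`. [cite: Balaban1984PropagatorsII, (2.1) p.224, bookkeeping] -/
theorem blockReadingY_val (hNf : ∀ μ, (toKT i).NB μ = (ℓ + 1) ^ i.k * Nf μ) (z : SiteY i) (μ : Fin (d + 1)) :
    (((UT.toSite Nf (blockReadingY i hNf z) μ).val : ℕ) : ℤ) = z.1 μ / (((ℓ + 1) ^ i.k : ℕ) : ℤ) :=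
  Int.toNat_of_nonneg (Int.ediv_nonneg ((mem_boxDom.1 z.2) μ).1 (by positivity))

/-- blocks of every level nest in the unit blocks: `⌊z∕L^k⌋ = ⌊⌊z∕L^j⌋∕L^{k−j}⌋` for `j ≤ k`. [cite: Balaban1984PropagatorsI, (1.6) p.18, (1.18) p.20 (nested blocks), bookkeeping] -/
theorem ediv_pow_eq_ediv_ediv {j k : ℕ} (hjk : j ≤ k) (z : ℤ) :
    z / (((ℓ + 1) ^ k : ℕ) : ℤ) = z / (((ℓ + 1) ^ j : ℕ) : ℤ) / (((ℓ + 1) ^ (k - j) : ℕ) : ℤ) := by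
  rw [Int.ediv_ediv_of_nonneg (by positivity)]
  congr 1
  rw [← Nat.cast_mul, ← pow_add, Nat.add_sub_cancel' hjk]

/-- ★ **AVERAGING PARTNERS HAVE THE SAME BLOCK READING** (`L^{lev z}`-blocks nest in `L^k`-blocks): the binder `hℓa` holds with ANY `s ≥ 0`.
[cite: Balaban1985BackgroundPropagators, (3.24) p.394; Balaban1984PropagatorsI, (1.18) p.20] -/
theorem blockReadingY_eq_of_avgCoeffY_ne_zero (hNf : ∀ μ, (toKT i).NB μ = (ℓ + 1) ^ i.k * Nf μ) {z w : SiteY i} (h : avgCoeffY i z w ≠ 0) :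
    blockReadingY i hNf z = blockReadingY i hNf w := by
  have hq := blk_eq_of_avgCoeffY_ne_zero i h
  funext μ
  apply Fin.ext
  show (z.1 μ / (((ℓ + 1) ^ i.k : ℕ) : ℤ)).toNat = (w.1 μ / (((ℓ + 1) ^ i.k : ℕ) : ℤ)).toNat
  have hμ : w.1 μ / (((ℓ + 1) ^ levY i z : ℕ) : ℤ) = z.1 μ / (((ℓ + 1) ^ levY i z : ℕ) : ℤ) := by
    have := congrFun hq μ; simpa only [blk] using this
  have hlev : levY i z ≤ i.k := (toKT i).D.lev_le z.1
  rw [ediv_pow_eq_ediv_ediv hlev, ediv_pow_eq_ediv_ediv hlev (w.1 μ), hμ]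

/-- the block reading is injective on each unit block up to the `L^k` offsets: over a unit-torus site sit at most `(L^k)^{d+1}` box sites (exactly, when
`L^k ∣ N₀`). [cite: Balaban1984PropagatorsII, (2.1) p.224, bookkeeping] -/
theorem eq_of_blockReadingY_eq_of_emod_eq (hNf : ∀ μ, (toKT i).NB μ = (ℓ + 1) ^ i.k * Nf μ) {z w : SiteY i}
    (h : blockReadingY i hNf z = blockReadingY i hNf w)
    (hr : ∀ μ, z.1 μ % (((ℓ + 1) ^ i.k : ℕ) : ℤ) = w.1 μ % (((ℓ + 1) ^ i.k : ℕ) : ℤ)) : z = w := by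
  apply Subtype.ext
  funext μ
  have hqμ : z.1 μ / (((ℓ + 1) ^ i.k : ℕ) : ℤ) = w.1 μ / (((ℓ + 1) ^ i.k : ℕ) : ℤ) := by
    rw [← blockReadingY_val i hNf z μ, ← blockReadingY_val i hNf w μ, h]
  rw [← Int.mul_ediv_add_emod (z.1 μ) (((ℓ + 1) ^ i.k : ℕ) : ℤ), ← Int.mul_ediv_add_emod (w.1 μ) (((ℓ + 1) ^ i.k : ℕ) : ℤ), hqμ, hr μ]

/-- ★ **THE FIBRE BINDER `hfib` AT THE BLOCK READING with the number `m = (L^k)^{d+1}·#κ`**.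
[cite: Balaban1985BackgroundPropagators, Thm 3.10 (3.107)–(3.108) p.416 (multiplicities); Balaban1988RG2Cluster, (2.5) p.12] -/
theorem hfib_blockReadingY {κ : Type} [Fintype κ] [DecidableEq κ] (hNf : ∀ μ, (toKT i).NB μ = (ℓ + 1) ^ i.k * Nf μ) (y : UT Nf) :
    (univ.filter fun p : SiteY i × κ => blockReadingY i hNf p.1 = y).card ≤ ((ℓ + 1) ^ i.k) ^ (d + 1) * Fintype.card κ := by
  have hb : (0 : ℤ) < (((ℓ + 1) ^ i.k : ℕ) : ℤ) := by positivity
  -- the remainder chart `p ↦ ((z_μ mod L^k)_μ, k)` is injective on the fibre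
  let f : SiteY i × κ → (Fin (d + 1) → Fin ((ℓ + 1) ^ i.k)) × κ := fun p =>
    (fun μ => ⟨(p.1.1 μ % (((ℓ + 1) ^ i.k : ℕ) : ℤ)).toNat, by
      have h0 := Int.emod_nonneg (p.1.1 μ) hb.ne'
      have h1 := Int.emod_lt_of_pos (p.1.1 μ) hb
      omega⟩, p.2)
  have hcard : Fintype.card ((Fin (d + 1) → Fin ((ℓ + 1) ^ i.k)) × κ) = ((ℓ + 1) ^ i.k) ^ (d + 1) * Fintype.card κ := by
    rw [Fintype.card_prod, Fintype.card_fun, Fintype.card_fin, Fintype.card_fin]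
  rw [← hcard, ← Finset.card_univ]
  refine Finset.card_le_card_of_injOn f (fun _ _ => Finset.mem_coe.2 (Finset.mem_univ _)) ?_
  intro p hp q hq hpq
  rw [Finset.mem_coe, Finset.mem_filter] at hp hq
  have h2 : p.2 = q.2 := by have h := congrArg Prod.snd hpq; exact h
  have h1 : ∀ μ, p.1.1 μ % (((ℓ + 1) ^ i.k : ℕ) : ℤ) = q.1.1 μ % (((ℓ + 1) ^ i.k : ℕ) : ℤ) := fun μ => by
    have hμ := congrArg (fun x : (Fin (d + 1) → Fin ((ℓ + 1) ^ i.k)) × κ => ((x.1 μ).val : ℤ)) hpq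
    simp only [f] at hμ
    rwa [Int.toNat_of_nonneg (Int.emod_nonneg _ hb.ne'), Int.toNat_of_nonneg (Int.emod_nonneg _ hb.ne')] at hμ
  exact Prod.ext (eq_of_blockReadingY_eq_of_emod_eq i hNf (hp.2.trans hq.2.symm) h1) h2

variable [∀ μ, NeZero (Nf μ)]

/-- the coordinate distances of two block readings are the circular distances of the block labels. [cite: Balaban1984PropagatorsII, (2.46) p.231, bookkeeping] -/
theorem ccoord_blockReadingY (hNf : ∀ μ, (toKT i).NB μ = (ℓ + 1) ^ i.k * Nf μ) (z w : SiteY i) (μ : Fin (d + 1)) :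
    ((ccoord Nf (UT.toSite Nf (blockReadingY i hNf z)) (UT.toSite Nf (blockReadingY i hNf w)) μ : ℕ) : ℤ) =
      circAbs (Nf μ) (z.1 μ / (((ℓ + 1) ^ i.k : ℕ) : ℤ) - w.1 μ / (((ℓ + 1) ^ i.k : ℕ) : ℤ)) := by
  rw [ccoord_cast (UT.one_le Nf), blockReadingY_val, blockReadingY_val]

/-- the `ℓ¹` unit-torus distance of two block readings, in block labels. [cite: Balaban1984PropagatorsII, (2.46) p.231, bookkeeping] -/
theorem tdist1_blockReadingY_eq (hNf : ∀ μ, (toKT i).NB μ = (ℓ + 1) ^ i.k * Nf μ) (z w : SiteY i) :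
    tdist1 Nf (blockReadingY i hNf z) (blockReadingY i hNf w) =
      ∑ μ, ((circAbs (Nf μ) (z.1 μ / (((ℓ + 1) ^ i.k : ℕ) : ℤ) - w.1 μ / (((ℓ + 1) ^ i.k : ℕ) : ℤ)) : ℤ) : ℝ) := by
  unfold tdist1
  refine Finset.sum_congr rfl fun μ _ => ?_
  rw [← ccoord_blockReadingY i hNf z w μ, Int.cast_natCast]

/-- ★ **THE AVERAGING-PARTNER BINDER `hℓa` AT THE BLOCK READING, with ANY `s ≥ 0`** (partners share the unit block).
[cite: Balaban1985BackgroundPropagators, (3.24) p.394, (3.107)–(3.108) p.416] -/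
theorem hℓa_blockReadingY (hNf : ∀ μ, (toKT i).NB μ = (ℓ + 1) ^ i.k * Nf μ) {s : ℝ} (hs : 0 ≤ s) (z w : SiteY i)
    (h : avgCoeffY i z w ≠ 0) : tdist1 Nf (blockReadingY i hNf z) (blockReadingY i hNf w) ≤ s := by
  rw [blockReadingY_eq_of_avgCoeffY_ne_zero i hNf h, B9Thm37GlueTorus.tdist1_self]; exact hs

/-- ★ **THE STEP BINDER `hℓ` AT THE BLOCK READING with the number `s = 1`**: one lattice step changes at most one block label, by at most one (torus-wise).
[cite: Balaban1985BackgroundPropagators, (3.3) p.390, (3.107)–(3.108) p.416; Balaban1988RG2Cluster, (2.5) p.12] -/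
theorem hℓ_blockReadingY (hNf : ∀ μ, (toKT i).NB μ = (ℓ + 1) ^ i.k * Nf μ) (μ : Fin (d + 1)) (z : SiteY i) :
    tdist1 Nf (blockReadingY i hNf (shiftY i μ z)) (blockReadingY i hNf z) ≤ 1 := by
  rw [tdist1_blockReadingY_eq]
  set b : ℤ := (((ℓ + 1) ^ i.k : ℕ) : ℤ) with hbdef
  have hb : 0 < b := by positivity
  have key : ∀ ν, circAbs (Nf ν) ((shiftY i μ z).1 ν / b - z.1 ν / b) = circAbs (Nf ν) ((z.1 ν + unitVec μ ν) / b - z.1 ν / b) := fun ν => by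
    have hv : (shiftY i μ z).1 ν = (z.1 ν + unitVec μ ν) % ((toKT i).NB ν : ℤ) := by
      show (tshift (toKT i).NB (unitVec μ) z).1 ν = _
      rw [tshift_val]; rfl
    have hN : ((toKT i).NB ν : ℤ) = b * (Nf ν : ℤ) := by rw [hbdef]; exact_mod_cast hNf ν
    rw [hv, Int.emod_def, hN, mul_assoc, Int.sub_mul_ediv_left _ _ hb.ne']
    have : (z.1 ν + unitVec μ ν) / b - (Nf ν : ℤ) * ((z.1 ν + unitVec μ ν) / (b * (Nf ν : ℤ))) - z.1 ν / b =
        ((z.1 ν + unitVec μ ν) / b - z.1 ν / b) + (Nf ν : ℤ) * (-((z.1 ν + unitVec μ ν) / (b * (Nf ν : ℤ)))) := by ring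
    rw [this, circAbs_add_mul]
  have step : ∀ ν, |(z.1 ν + unitVec μ ν) / b - z.1 ν / b| ≤ unitVec μ ν := fun ν => by
    by_cases hν : ν = μ
    · subst hν
      have h1 : unitVec ν ν = 1 := by simp [unitVec]
      rw [h1]
      have hlo : z.1 ν / b ≤ (z.1 ν + 1) / b := Int.ediv_le_ediv hb (by linarith)
      have hhi : (z.1 ν + 1) / b ≤ z.1 ν / b + 1 := by
        have := Int.ediv_le_ediv hb (show z.1 ν + 1 ≤ z.1 ν + 1 * b by linarith)
        rwa [Int.add_mul_ediv_right _ _ hb.ne'] at this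
      rw [abs_le]; constructor <;> linarith
    · have h0 : unitVec μ ν = 0 := by simp [unitVec, Pi.single_eq_of_ne hν]
      rw [h0, add_zero, sub_self, abs_zero]
  calc ∑ ν, ((circAbs (Nf ν) ((shiftY i μ z).1 ν / b - z.1 ν / b) : ℤ) : ℝ)
      = ∑ ν, ((circAbs (Nf ν) ((z.1 ν + unitVec μ ν) / b - z.1 ν / b) : ℤ) : ℝ) := by simp_rw [key]
    _ ≤ ∑ ν, ((unitVec μ ν : ℤ) : ℝ) := Finset.sum_le_sum fun ν _ => by
        exact_mod_cast (circAbs_le_abs (UT.one_le Nf ν) _).trans (step ν)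
    _ = 1 := by rw [← Int.cast_sum, sum_unitVec]; simp

/-- ★★ **THE RATE BINDER AT THE BLOCK READING IS AFFINE**: `L^k·d₁(ℓ_blk z, ℓ_blk w) ≤ (d+1)·|z − w|_T + (d+1)·(L^k − 1)`, i.e. with `κ = 1∕(d+1)` and
rounding constant `c₀ = 1`: `κ·d₁(ℓ_blk z, ℓ_blk w) ≤ |z − w|_T∕L^k + 1` (LOCATED: the multiplicative binder of 79 caps the block reading at `κ ≤ 1∕L^k`,
`blockReadingY_rate_le_inv_of_mul`). [cite: Balaban1985BackgroundPropagators, Thm 3.1 (3.42) p.397; Balaban1988RG2Cluster, (2.5) p.12, p.15] -/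
theorem hκ_blockReadingY_affine (hNf : ∀ μ, (toKT i).NB μ = (ℓ + 1) ^ i.k * Nf μ) (z w : SiteY i) :
    (((d : ℝ) + 1))⁻¹ * tdist1 Nf (blockReadingY i hNf z) (blockReadingY i hNf w) ≤
      ((((ℓ + 1) ^ i.k : ℕ) : ℝ))⁻¹ * torusSupNorm (toKT i).NB (z.1 - w.1) + 1 := by
  rw [tdist1_blockReadingY_eq]
  set b : ℕ := (ℓ + 1) ^ i.k with hbdef
  have hb1 : 1 ≤ b := Nat.one_le_pow _ _ (Nat.succ_pos ℓ)
  have hbR : (0 : ℝ) < (b : ℝ) := by exact_mod_cast hb1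
  have hd1 : (0 : ℝ) < (d : ℝ) + 1 := by positivity
  have hT0 : ∀ μ, ((circAbs ((toKT i).NB μ) ((z.1 - w.1) μ) : ℤ) : ℝ) ≤ torusSupNorm (toKT i).NB (z.1 - w.1) := fun μ =>
    Finset.le_sup' (fun j => ((circAbs ((toKT i).NB j) ((z.1 - w.1) j) : ℤ) : ℝ)) (Finset.mem_univ μ)
  have hcoord : ∀ μ, (b : ℝ) * ((circAbs (Nf μ) (z.1 μ / (b : ℤ) - w.1 μ / (b : ℤ)) : ℤ) : ℝ) ≤
      torusSupNorm (toKT i).NB (z.1 - w.1) + ((b : ℝ) - 1) := fun μ => by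
    have h := mul_circAbs_ediv_sub_ediv_le hb1 (UT.one_le Nf μ) (z.1 μ) (w.1 μ)
    rw [← hNf μ] at h
    have h' : ((b : ℤ) : ℝ) * ((circAbs (Nf μ) (z.1 μ / (b : ℤ) - w.1 μ / (b : ℤ)) : ℤ) : ℝ) ≤
        ((circAbs ((toKT i).NB μ) (z.1 μ - w.1 μ) : ℤ) : ℝ) + (((b : ℤ) : ℝ) - 1) := by exact_mod_cast h
    have hμ := hT0 μ
    rw [Pi.sub_apply] at hμ
    push_cast at h' ⊢
    linarith
  have hsum : (b : ℝ) * ∑ μ, ((circAbs (Nf μ) (z.1 μ / (b : ℤ) - w.1 μ / (b : ℤ)) : ℤ) : ℝ) ≤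
      ((d : ℝ) + 1) * torusSupNorm (toKT i).NB (z.1 - w.1) + ((d : ℝ) + 1) * ((b : ℝ) - 1) := by
    rw [Finset.mul_sum]
    calc ∑ μ, (b : ℝ) * ((circAbs (Nf μ) (z.1 μ / (b : ℤ) - w.1 μ / (b : ℤ)) : ℤ) : ℝ)
        ≤ ∑ _μ : Fin (d + 1), (torusSupNorm (toKT i).NB (z.1 - w.1) + ((b : ℝ) - 1)) := Finset.sum_le_sum fun μ _ => hcoord μ
      _ = ((d : ℝ) + 1) * torusSupNorm (toKT i).NB (z.1 - w.1) + ((d : ℝ) + 1) * ((b : ℝ) - 1) := by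
          rw [Finset.sum_const, Finset.card_univ, Fintype.card_fin, nsmul_eq_mul]; push_cast; ring
  have hS0 : 0 ≤ ∑ μ, ((circAbs (Nf μ) (z.1 μ / (b : ℤ) - w.1 μ / (b : ℤ)) : ℤ) : ℝ) :=
    Finset.sum_nonneg fun μ _ => by exact_mod_cast circAbs_nonneg (UT.one_le Nf μ) _
  have hbcast : (((ℓ + 1) ^ i.k : ℕ) : ℝ) = (b : ℝ) := by rw [hbdef]
  rw [hbcast]
  rw [show (((ℓ + 1) ^ i.k : ℕ) : ℤ) = (b : ℤ) by rw [hbdef]] 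
  -- divide `hsum` by `(d+1)·b`
  have key : (((d : ℝ) + 1))⁻¹ * ∑ μ, ((circAbs (Nf μ) (z.1 μ / (b : ℤ) - w.1 μ / (b : ℤ)) : ℤ) : ℝ) ≤
      (b : ℝ)⁻¹ * torusSupNorm (toKT i).NB (z.1 - w.1) + ((b : ℝ) - 1) / b := by
    rw [inv_mul_le_iff₀ hd1]
    have : ((d : ℝ) + 1) * ((b : ℝ)⁻¹ * torusSupNorm (toKT i).NB (z.1 - w.1) + ((b : ℝ) - 1) / b) =
        (b : ℝ)⁻¹ * (((d : ℝ) + 1) * torusSupNorm (toKT i).NB (z.1 - w.1) + ((d : ℝ) + 1) * ((b : ℝ) - 1)) := by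
      field_simp
    rw [this, le_inv_mul_iff₀ hbR]
    exact hsum
  have hfrac : ((b : ℝ) - 1) / b ≤ 1 := by rw [div_le_one hbR]; linarith
  linarith

/-- ★ **LOCATED — THE MULTIPLICATIVE RATE BINDER CAPS THE BLOCK READING AT `κ ≤ 1∕L^k`**: if some `κ` satisfies 79's binder `κ·d₁(ℓ_blk z, ℓ_blk w) ≤ |z − w|_T∕L^k`
for ALL pairs, then `κ ≤ 1∕L^k` as soon as one direction has two unit blocks (`2 ≤ Nf μ₀`) — witnessed by the two neighbours `z = L^k·e_{μ₀}`, `w = (L^k − 1)·e_{μ₀}`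
across a block face (`d₁ = 1 = |z − w|_T`).  So through the multiplicative binder the block reading only carries the rate `δ₀∕L^k` per unit block; the affine binder
(`hκ_blockReadingY_affine`) carries `δ₀∕(d+1)`. [cite: Balaban1985BackgroundPropagators, Thm 3.1 (3.42) p.397; Balaban1988RG2Cluster, (2.5) p.12, p.15] -/
theorem blockReadingY_rate_le_inv_of_mul (hNf : ∀ μ, (toKT i).NB μ = (ℓ + 1) ^ i.k * Nf μ) (μ₀ : Fin (d + 1)) (h2 : 2 ≤ Nf μ₀) {κr : ℝ}
    (hκ : ∀ z w : SiteY i, κr * tdist1 Nf (blockReadingY i hNf z) (blockReadingY i hNf w) ≤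
      ((((ℓ + 1) ^ i.k : ℕ) : ℝ))⁻¹ * torusSupNorm (toKT i).NB (z.1 - w.1)) :
    κr ≤ ((((ℓ + 1) ^ i.k : ℕ) : ℝ))⁻¹ := by
  have hb1 : 1 ≤ (ℓ + 1) ^ i.k := Nat.one_le_pow _ _ (Nat.succ_pos ℓ)
  have hb1z : (1 : ℤ) ≤ (((ℓ + 1) ^ i.k : ℕ) : ℤ) := by exact_mod_cast hb1
  have hNB : ∀ μ, 1 ≤ (toKT i).NB μ := fun μ =>
    B6MultiLevelTorusOperator.one_le_N0 (toKT i).hMh (toKT i).hP μ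
  have hNf1 : ∀ μ, 1 ≤ Nf μ := fun μ => UT.one_le Nf μ
  have hNBz : ∀ μ, ((toKT i).NB μ : ℤ) = (((ℓ + 1) ^ i.k : ℕ) : ℤ) * (Nf μ : ℤ) := fun μ => by exact_mod_cast hNf μ
  have h2z : (2 : ℤ) ≤ (Nf μ₀ : ℤ) := by exact_mod_cast h2
  have hbig : (((ℓ + 1) ^ i.k : ℕ) : ℤ) < ((toKT i).NB μ₀ : ℤ) := by rw [hNBz μ₀]; nlinarith
  -- the two neighbours across the face of the first unit block in direction `μ₀`
  have hzmem : (fun μ => if μ = μ₀ then (((ℓ + 1) ^ i.k : ℕ) : ℤ) else 0) ∈ (toKT i).XB := by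
    rw [mem_boxDom]; intro μ
    by_cases hμ : μ = μ₀
    · rw [if_pos hμ, hμ]; exact ⟨by positivity, hbig⟩
    · rw [if_neg hμ]; exact ⟨le_rfl, by exact_mod_cast hNB μ⟩
  have hwmem : (fun μ => if μ = μ₀ then (((ℓ + 1) ^ i.k : ℕ) : ℤ) - 1 else 0) ∈ (toKT i).XB := by
    rw [mem_boxDom]; intro μ
    by_cases hμ : μ = μ₀
    · rw [if_pos hμ, hμ]; exact ⟨by linarith, by linarith⟩
    · rw [if_neg hμ]; exact ⟨le_rfl, by exact_mod_cast hNB μ⟩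
  -- their label difference is the unit vector
  have hdiff : (⟨_, hzmem⟩ : SiteY i).1 - (⟨_, hwmem⟩ : SiteY i).1 = unitVec μ₀ := by
    funext μ
    simp only [Pi.sub_apply, unitVec]
    by_cases hμ : μ = μ₀
    · rw [if_pos hμ, if_pos hμ, hμ, Pi.single_eq_same]; ring
    · rw [if_neg hμ, if_neg hμ, Pi.single_eq_of_ne hμ]; ring
  have hunit_le : ∀ μ, unitVec μ₀ μ ≤ 1 := fun μ => by
    unfold unitVec
    by_cases hμ : μ = μ₀
    · rw [hμ, Pi.single_eq_same]
    · rw [Pi.single_eq_of_ne hμ]; exact zero_le_one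
  have hunit_self : unitVec μ₀ μ₀ = 1 := by simp [unitVec]
  -- `|z − w|_T = 1`
  have hT : torusSupNorm (toKT i).NB ((⟨_, hzmem⟩ : SiteY i).1 - (⟨_, hwmem⟩ : SiteY i).1) = 1 := by
    rw [hdiff]
    unfold torusSupNorm
    refine le_antisymm (Finset.sup'_le _ _ fun μ _ => ?_) ?_
    · have h := circAbs_le_abs (hNB μ) (unitVec μ₀ μ)
      rw [abs_unitVec] at h
      exact_mod_cast h.trans (hunit_le μ)
    · refine le_trans (le_of_eq ?_) (Finset.le_sup' (fun j => ((circAbs ((toKT i).NB j) (unitVec μ₀ j) : ℤ) : ℝ)) (Finset.mem_univ μ₀))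
      have hN2 : 2 * |(1 : ℤ)| ≤ ((toKT i).NB μ₀ : ℤ) := by rw [abs_one]; linarith
      rw [hunit_self, circAbs_of_centred (hNB μ₀) hN2, abs_one]
      simp
  -- `d₁(ℓ_blk z, ℓ_blk w) = 1`
  have hD1 : tdist1 Nf (blockReadingY i hNf ⟨_, hzmem⟩) (blockReadingY i hNf ⟨_, hwmem⟩) = 1 := by
    rw [tdist1_blockReadingY_eq]
    have hq : ∀ μ, (⟨_, hzmem⟩ : SiteY i).1 μ / (((ℓ + 1) ^ i.k : ℕ) : ℤ) - (⟨_, hwmem⟩ : SiteY i).1 μ / (((ℓ + 1) ^ i.k : ℕ) : ℤ) =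
        unitVec μ₀ μ := fun μ => by
      by_cases hμ : μ = μ₀
      · have hz : (⟨_, hzmem⟩ : SiteY i).1 μ = (((ℓ + 1) ^ i.k : ℕ) : ℤ) := if_pos hμ
        have hw : (⟨_, hwmem⟩ : SiteY i).1 μ = (((ℓ + 1) ^ i.k : ℕ) : ℤ) - 1 := if_pos hμ
        have hb0 : (((ℓ + 1) ^ i.k : ℕ) : ℤ) ≠ 0 := by positivity
        have e1 : ((((ℓ + 1) ^ i.k : ℕ) : ℤ) - 1) / (((ℓ + 1) ^ i.k : ℕ) : ℤ) = 0 :=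
          Int.ediv_eq_zero_of_lt (by linarith) (by linarith)
        rw [hz, hw, Int.ediv_self hb0, e1, hμ, hunit_self]; norm_num
      · have hz : (⟨_, hzmem⟩ : SiteY i).1 μ = 0 := if_neg hμ
        have hw : (⟨_, hwmem⟩ : SiteY i).1 μ = 0 := if_neg hμ
        rw [hz, hw]
        simp [unitVec, Pi.single_eq_of_ne hμ]
    simp_rw [hq]
    have hterm : ∀ μ, ((circAbs (Nf μ) (unitVec μ₀ μ) : ℤ) : ℝ) = ((unitVec μ₀ μ : ℤ) : ℝ) := fun μ => by
      by_cases hμ : μ = μ₀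
      · have hN2 : 2 * |(1 : ℤ)| ≤ (Nf μ : ℤ) := by rw [abs_one, hμ]; exact h2z
        rw [hμ, hunit_self]
        rw [hμ] at hN2
        rw [circAbs_of_centred (hNf1 μ₀) hN2, abs_one]
      · have h0 : unitVec μ₀ μ = 0 := by simp [unitVec, Pi.single_eq_of_ne hμ]
        rw [h0]
        have : circAbs (Nf μ) 0 = 0 :=
          le_antisymm ((circAbs_le_abs (hNf1 μ) 0).trans (by simp)) (circAbs_nonneg (hNf1 μ) 0)
        rw [this]
    simp_rw [hterm]
    rw [← Int.cast_sum, sum_unitVec]; simp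
  have h := hκ ⟨_, hzmem⟩ ⟨_, hwmem⟩
  rw [hD1, hT, mul_one, mul_one] at h
  exact h

end Block

/-! ## §4. Module 79 through the readings: the G′-factor's N10 letters with NO reading ∕ averaging numeral displayed -/

section Knit

open Metric Module
open scoped Matrix Matrix.Norms.L2Operator
open B6MultiLevelBoxOperator B6MultiLevelTorusOperator B9BackgroundsKLevelV1
open Literature.MathematicalPhysics.QuantumFieldTheory.Balaban1983to89.B13EntrywiseWalks (RawEntryLetters)
open Literature.MathematicalPhysics.QuantumFieldTheory.Balaban1983to89.B13GreenPrimeSymLettersOfReg335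
  (norm_GpY_parSymY_single_le_of_reg335 norm_unit_le_one_of_mem rawEntryLetters_toMatrix_GpY_parSymY_prodCfg_of_reg335_record)
open Literature.MathematicalPhysics.QuantumFieldTheory.Balaban1983to89.B13OpsYPencilGreenPrimeSym (rawEntryLetters_toMatrix_GpY_parSymY_prodCfg_of_pencil)
open Literature.MathematicalPhysics.QuantumFieldTheory.Balaban1983to89.B13MatrixUnitBasisNumerals (norm_stdBasis_repr_le norm_stdBasis_le_one)
open Literature.MathematicalPhysics.QuantumFieldTheory.Balaban1983to89.B9Thm311DeltaPrimePos (isUnit_deltaPrimeAY_parSymY)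
open Literature.MathematicalPhysics.QuantumFieldTheory.Balaban1983to89.B9Eq39Adjoint (prodCfg)

variable (i : KIdx d ℓ hd hL b₀ b₁) {N : ℕ} {G : Subgroup (Matrix (Fin N) (Fin N) ℂ)ˣ}

/-- ★★ **THEOREM 3.1's KERNEL DECAY THROUGH AN AFFINE READING**: if `κ·d₁(ℓ z, ℓ w) ≤ |z − w|_T∕L^k + c₀` (`c₀` a rounding constant — `c₀ = 0` is 79's
multiplicative binder, `c₀ = 1`, `κ = 1∕(d+1)` the block reading) then `‖(G′(U)(δ_x ⊗ E))(y)‖ ≤ e^{δ₀c₀}·16·(L^k)²·√N·‖E‖·e^{−(δ₀κ)·d₁(ℓ y, ℓ x)}` on the (3.35)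
class, `δ₀ = 1∕(4(d+2))`. [cite: Balaban1985BackgroundPropagators, Thm 3.1 (3.42) p.397, (3.35) p.396, (3.107)–(3.108) p.416; Balaban1988RG2Cluster, (2.5) p.12, p.15; Agmon1982, Ch.1] -/
theorem norm_GpY_parSymY_single_le_of_reg335_affineReading [Nonempty (Fin N)] (hG : G ≤ B7Prop2Explicit.unitaryUnits (Matrix (Fin N) (Fin N) ℂ))
    {U : CfgY (Matrix (Fin N) (Fin N) ℂ) i} {c α₀ : ℝ} (hC0 : 0 ≤ c * (kGeo i).M * α₀) (hC1 : c * (kGeo i).M * α₀ * ((d : ℝ) + 1) ≤ 1 / 16)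
    (hreg : (bg9K (Matrix (Fin N) (Fin N) ℂ) G i).Reg335 c α₀ U)
    {ν : ℕ} {Nf : Fin ν → ℕ} [∀ j, NeZero (Nf j)] (ℓ' : SiteY i → UT Nf) {κr c₀ : ℝ}
    (hκ : ∀ z w : SiteY i, κr * tdist1 Nf (ℓ' z) (ℓ' w) ≤ ((((ℓ + 1) ^ i.k : ℕ) : ℝ))⁻¹ * torusSupNorm (toKT i).NB (z.1 - w.1) + c₀)
    (x y : SiteY i) (E : Matrix (Fin N) (Fin N) ℂ) :
    ‖GpY i (parSymY i) U (Pi.single x E) y‖ ≤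
      (Real.exp ((1 / (4 * ((d : ℝ) + 2))) * c₀) * (16 * ((((ℓ + 1) ^ i.k : ℕ) : ℝ)) ^ 2 * Real.sqrt N)) * ‖E‖ *
        Real.exp (-(((1 / (4 * ((d : ℝ) + 2))) * κr) * tdist1 Nf (ℓ' y) (ℓ' x))) := by
  have h := norm_GpY_parSymY_single_le_of_reg335 i hG hC0 hC1 hreg x y E
  have hδ : (0 : ℝ) ≤ 1 / (4 * ((d : ℝ) + 2)) := by positivity
  have hk := hκ y x
  have hexp : Real.exp (-((1 / (4 * ((d : ℝ) + 2))) * (((((ℓ + 1) ^ i.k : ℕ) : ℝ))⁻¹ * torusSupNorm (toKT i).NB (y.1 - x.1)))) ≤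
      Real.exp ((1 / (4 * ((d : ℝ) + 2))) * c₀) * Real.exp (-(((1 / (4 * ((d : ℝ) + 2))) * κr) * tdist1 Nf (ℓ' y) (ℓ' x))) := by
    rw [← Real.exp_add]
    apply Real.exp_le_exp.2
    have := mul_le_mul_of_nonneg_left hk hδ
    nlinarith
  have hC : 0 ≤ 16 * ((((ℓ + 1) ^ i.k : ℕ) : ℝ)) ^ 2 * Real.sqrt N * ‖E‖ :=
    mul_nonneg (mul_nonneg (by positivity) (Real.sqrt_nonneg _)) (norm_nonneg _)
  calc ‖GpY i (parSymY i) U (Pi.single x E) y‖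
      ≤ 16 * ((((ℓ + 1) ^ i.k : ℕ) : ℝ)) ^ 2 * Real.sqrt N * ‖E‖ *
          Real.exp (-((1 / (4 * ((d : ℝ) + 2))) * (((((ℓ + 1) ^ i.k : ℕ) : ℝ))⁻¹ * torusSupNorm (toKT i).NB (y.1 - x.1)))) := h
    _ ≤ 16 * ((((ℓ + 1) ^ i.k : ℕ) : ℝ)) ^ 2 * Real.sqrt N * ‖E‖ *
          (Real.exp ((1 / (4 * ((d : ℝ) + 2))) * c₀) * Real.exp (-(((1 / (4 * ((d : ℝ) + 2))) * κr) * tdist1 Nf (ℓ' y) (ℓ' x)))) :=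
        mul_le_mul_of_nonneg_left hexp hC
    _ = _ := by ring

/-- at matrix units over each fine-read site sit at most `N²` indices. [cite: Balaban1985BackgroundPropagators, (3.107)–(3.108) p.416, bookkeeping] -/
theorem hfib_fineReadingY_matrixUnits {Nf : Fin (d + 1) → ℕ} (hNf : ∀ μ, (toKT i).NB μ = Nf μ) (y : UT Nf) :
    (univ.filter fun p : SiteY i × (Fin N × Fin N) => fineReadingY i hNf p.1 = y).card ≤ N * N :=
  (hfib_fineReadingY i hNf y).trans (by simp [Fintype.card_prod, Fintype.card_fin])

/-- ★★★ **79 §2 AT THE RECORD's COORDINATES AND THE FINE READING — NO READING OR AVERAGING NUMERAL DISPLAYED.**  For every background `U₀` of the (3.35) class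
(`G ≤ U(N)`, `0 ≤ c·M·α₀`, `c·M·α₀·(d+1) ≤ 1∕16`), along pv27's pencil `A′ ↦ e^{iηA′}U₀`, the matrix-unit coordinates of `G′ = (Δ′_a)⁻¹` have the N10 letters
`RawEntryLetters (A′ ↦ toMatrix (G′(e^{iηA′}U₀))) (ℓ_fine ∘ fst) R ρ′ (2·16(L^k)²√N)` on the V1 torus `UT (sitesPerDir 0)` for every `0 ≤ ρ′ < δ₀∕((d+1)L^k)`, with
`Cavg = 1`, `D = 2(d+1)(L^k − 1)`, `s = (d+1)L^k`, `κ = 1∕((d+1)L^k)`, `m = N²` NUMBERS of this file; remaining displayed: `η`, the thin radius `Rc > 0`, `ρ′`, the (3.35)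
data. LOCATED INSTANCE (which reading the term tower of record uses is NODE 00's ∕ def-T's word). [cite: Balaban1985BackgroundPropagators, (3.24)–(3.25) p.394, (3.35) p.396,
Thm 3.1 (3.42) p.397, Thm 3.4 p.400, (3.60)–(3.65) p.402, Thm 3.10 (3.107)–(3.108) p.416; Balaban1988RG2Cluster, (2.5)–(2.7) pp.12–13, p.15] -/
theorem rawEntryLetters_toMatrix_GpY_parSymY_prodCfg_of_reg335_fineReading_record [NeZero N]
    (hG : G ≤ B7Prop2Explicit.unitaryUnits (Matrix (Fin N) (Fin N) ℂ))
    {U₀ : CfgY (Matrix (Fin N) (Fin N) ℂ) i} {c α₀ : ℝ} (hC0 : 0 ≤ c * (kGeo i).M * α₀) (hC1 : c * (kGeo i).M * α₀ * ((d : ℝ) + 1) ≤ 1 / 16)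
    (hreg : (bg9K (Matrix (Fin N) (Fin N) ℂ) G i).Reg335 c α₀ U₀)
    (η : ℝ) {Rc : ℝ} (hRc : 0 < Rc) {ρ' : ℝ} (hρ'0 : 0 ≤ ρ')
    (hρ' : ρ' < (1 / (4 * ((d : ℝ) + 2))) * ((((d : ℝ) + 1) * ((((ℓ + 1) ^ i.k : ℕ) : ℝ)))⁻¹)) :
    RawEntryLetters (fun a : Fin (d + 1) → Site (PV d ℓ i.m i.K hd hL) 0 → Matrix (Fin N) (Fin N) ℂ =>
        LinearMap.toMatrix
          ((Pi.basis fun _ : SiteY i => Matrix.stdBasis ℂ (Fin N) (Fin N)).reindex (Equiv.sigmaEquivProd (SiteY i) (Fin N × Fin N)))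
          ((Pi.basis fun _ : SiteY i => Matrix.stdBasis ℂ (Fin N) (Fin N)).reindex (Equiv.sigmaEquivProd (SiteY i) (Fin N × Fin N)))
          (GpY i (parSymY i) (prodCfg U₀ η a)))
      (fun p : SiteY i × (Fin N × Fin N) => fineReadingY i i.hN p.1)
      (Rc / (4 * ((1 * (((d : ℝ) + 1) *
          (1 * Real.exp (|η| * Rc) * (1 * Real.exp (|η| * Rc) * 1 * (1 * Real.exp (|η| * Rc)) + 1) * (1 * Real.exp (|η| * Rc)) +
            (1 * Real.exp (|η| * Rc) * 1 * (1 * Real.exp (|η| * Rc)) + 1)) +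
          1 * ((1 * Real.exp (|η| * Rc)) ^ (2 * (d + 1) * ((ℓ + 1) ^ i.k - 1)) * 1 * (1 * Real.exp (|η| * Rc)) ^ (2 * (d + 1) * ((ℓ + 1) ^ i.k - 1)))) * Real.exp ((1 / (4 * ((d : ℝ) + 2)) * ((((d : ℝ) + 1) * ((((ℓ + 1) ^ i.k : ℕ) : ℝ)))⁻¹)) * (((d : ℝ) + 1) * ((((ℓ + 1) ^ i.k : ℕ) : ℝ))))) *
          (1 * 1 * (16 * ((((ℓ + 1) ^ i.k : ℕ) : ℝ)) ^ 2 * Real.sqrt N)) *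
          (((N * N : ℕ) : ℝ) * B6.c0 1 (((1 / (4 * ((d : ℝ) + 2))) * ((((d : ℝ) + 1) * ((((ℓ + 1) ^ i.k : ℕ) : ℝ)))⁻¹) - ρ') / 3) ^ (d + 1)) * (((N * N : ℕ) : ℝ) * B6.c0 1 (((1 / (4 * ((d : ℝ) + 2))) * ((((d : ℝ) + 1) * ((((ℓ + 1) ^ i.k : ℕ) : ℝ)))⁻¹) - ρ') / 3) ^ (d + 1))) + 1))
      ρ' (2 * (1 * 1 * (16 * ((((ℓ + 1) ^ i.k : ℕ) : ℝ)) ^ 2 * Real.sqrt N))) := by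
  have hs0 : (0 : ℝ) ≤ ((d : ℝ) + 1) * ((((ℓ + 1) ^ i.k : ℕ) : ℝ)) := by positivity
  have hκ0 : (0 : ℝ) ≤ ((((d : ℝ) + 1) * ((((ℓ + 1) ^ i.k : ℕ) : ℝ)))⁻¹) := by positivity
  exact rawEntryLetters_toMatrix_GpY_parSymY_prodCfg_of_reg335_record i hG hC0 hC1 hreg η hRc (hD_avgCoeffY i) zero_le_one (B9Thm37CubeCoverCommutatorSizes.sum_abs_avgCoeffY_le_one i)
    (fineReadingY i i.hN) hs0 (hℓ_fineReadingY i i.hN) (hℓa_fineReadingY i i.hN) hκ0 (hκ_fineReadingY i i.hN)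
    (hfib_fineReadingY_matrixUnits i i.hN) hρ'0 hρ'


/-- at matrix units over each block-read site sit at most `(L^k)^{d+1}·N²` indices. [cite: Balaban1985BackgroundPropagators, (3.107)–(3.108) p.416, bookkeeping] -/
theorem hfib_blockReadingY_matrixUnits {Nf : Fin (d + 1) → ℕ} (hNf : ∀ μ, (toKT i).NB μ = (ℓ + 1) ^ i.k * Nf μ) (y : UT Nf) :
    (univ.filter fun p : SiteY i × (Fin N × Fin N) => blockReadingY i hNf p.1 = y).card ≤ ((ℓ + 1) ^ i.k) ^ (d + 1) * (N * N) :=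
  (hfib_blockReadingY i hNf y).trans (by simp [Fintype.card_prod, Fintype.card_fin])

/-- ★★★ **THE G′-FACTOR's N10 LETTERS AT THE BLOCK READING (unit torus of the k-th step), RATE `ρ′ < δ₀∕(d+1)` PER UNIT BLOCK — NO READING OR AVERAGING
NUMERAL DISPLAYED.**  For every background `U₀` of the (3.35) class, along pv27's pencil, in matrix-unit coordinates:
`RawEntryLetters (A′ ↦ toMatrix (G′(e^{iηA′}U₀))) (ℓ_blk ∘ fst) R ρ′ (2·e^{δ₀}·16(L^k)²√N)` on ANY unit torus `UT Nf` with `N₀ = L^k·Nf` (the consumer's period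
vector and its `NeZero` instance), for every `0 ≤ ρ′ < δ₀∕(d+1)`: module 78's pencil junction `…GpY_parSymY_prodCfg_of_pencil` fed with N06's tree theorems
(`isUnit_deltaPrimeAY_parSymY`, Thm 3.1 via `norm_GpY_parSymY_single_le_of_reg335_affineReading` at `κ = 1∕(d+1)`, `c₀ = 1`) and this file's numbers
`Cavg = 1`, `D = 2(d+1)(L^k − 1)`, `s = 1`, `m = (L^k)^{d+1}N²`.  LOCATED INSTANCE; n06-w1's scope caveat (one finite lattice operator, `(L^k)²` prefactor) carries over.
[cite: Balaban1985BackgroundPropagators, (3.24)–(3.25) p.394, (3.35) p.396, Thm 3.1 (3.42) p.397, Thm 3.4 p.400, (3.60)–(3.65) p.402, Thm 3.10 (3.107)–(3.108) p.416;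
Balaban1988RG2Cluster, (2.5)–(2.7) pp.12–13, p.15; Balaban1984PropagatorsII, Lemma 2.1 (2.61) p.234] -/
theorem rawEntryLetters_toMatrix_GpY_parSymY_prodCfg_of_reg335_blockReading [NeZero N]
    (hG : G ≤ B7Prop2Explicit.unitaryUnits (Matrix (Fin N) (Fin N) ℂ))
    {U₀ : CfgY (Matrix (Fin N) (Fin N) ℂ) i} {c α₀ : ℝ} (hC0 : 0 ≤ c * (kGeo i).M * α₀) (hC1 : c * (kGeo i).M * α₀ * ((d : ℝ) + 1) ≤ 1 / 16)
    (hreg : (bg9K (Matrix (Fin N) (Fin N) ℂ) G i).Reg335 c α₀ U₀)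
    {Nf : Fin (d + 1) → ℕ} [∀ μ, NeZero (Nf μ)] (hNf : ∀ μ, (toKT i).NB μ = (ℓ + 1) ^ i.k * Nf μ)
    (η : ℝ) {Rc : ℝ} (hRc : 0 < Rc) {ρ' : ℝ} (hρ'0 : 0 ≤ ρ') (hρ' : ρ' < (1 / (4 * ((d : ℝ) + 2))) * (((d : ℝ) + 1))⁻¹) :
    RawEntryLetters (fun a : Fin (d + 1) → Site (PV d ℓ i.m i.K hd hL) 0 → Matrix (Fin N) (Fin N) ℂ =>
        LinearMap.toMatrix
          ((Pi.basis fun _ : SiteY i => Matrix.stdBasis ℂ (Fin N) (Fin N)).reindex (Equiv.sigmaEquivProd (SiteY i) (Fin N × Fin N)))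
          ((Pi.basis fun _ : SiteY i => Matrix.stdBasis ℂ (Fin N) (Fin N)).reindex (Equiv.sigmaEquivProd (SiteY i) (Fin N × Fin N)))
          (GpY i (parSymY i) (prodCfg U₀ η a)))
      (fun p : SiteY i × (Fin N × Fin N) => blockReadingY i hNf p.1)
      (Rc / (4 * ((1 * (((d : ℝ) + 1) *
          (1 * Real.exp (|η| * Rc) * (1 * Real.exp (|η| * Rc) * 1 * (1 * Real.exp (|η| * Rc)) + 1) * (1 * Real.exp (|η| * Rc)) +
            (1 * Real.exp (|η| * Rc) * 1 * (1 * Real.exp (|η| * Rc)) + 1)) +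
          1 * ((1 * Real.exp (|η| * Rc)) ^ (2 * (d + 1) * ((ℓ + 1) ^ i.k - 1)) * 1 * (1 * Real.exp (|η| * Rc)) ^ (2 * (d + 1) * ((ℓ + 1) ^ i.k - 1)))) * Real.exp ((1 / (4 * ((d : ℝ) + 2))) * (((d : ℝ) + 1))⁻¹ * 1)) *
          (1 * 1 * (Real.exp ((1 / (4 * ((d : ℝ) + 2))) * 1) * (16 * ((((ℓ + 1) ^ i.k : ℕ) : ℝ)) ^ 2 * Real.sqrt N))) * ((((((ℓ + 1) ^ i.k) ^ (d + 1) * (N * N) : ℕ)) : ℝ) * B6.c0 1 (((1 / (4 * ((d : ℝ) + 2))) * (((d : ℝ) + 1))⁻¹ - ρ') / 3) ^ (d + 1)) * ((((((ℓ + 1) ^ i.k) ^ (d + 1) * (N * N) : ℕ)) : ℝ) * B6.c0 1 (((1 / (4 * ((d : ℝ) + 2))) * (((d : ℝ) + 1))⁻¹ - ρ') / 3) ^ (d + 1))) + 1))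
      ρ' (2 * (1 * 1 * (Real.exp ((1 / (4 * ((d : ℝ) + 2))) * 1) * (16 * ((((ℓ + 1) ^ i.k : ℕ) : ℝ)) ^ 2 * Real.sqrt N)))) := by
  obtain ⟨hU, hUi⟩ := norm_unit_le_one_of_mem i hG hreg.1
  have hunit : IsUnit (deltaPrimeAY i (parSymY i) U₀) := isUnit_deltaPrimeAY_parSymY i hG hreg.1
  have hBG : 0 ≤ Real.exp ((1 / (4 * ((d : ℝ) + 2))) * 1) * (16 * ((((ℓ + 1) ^ i.k : ℕ) : ℝ)) ^ 2 * Real.sqrt N) :=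
    mul_nonneg (Real.exp_nonneg _) (mul_nonneg (by positivity) (Real.sqrt_nonneg _))
  have hρ : (0 : ℝ) ≤ (1 / (4 * ((d : ℝ) + 2))) * (((d : ℝ) + 1))⁻¹ := by positivity
  exact rawEntryLetters_toMatrix_GpY_parSymY_prodCfg_of_pencil i U₀ η (Matrix.stdBasis ℂ (Fin N) (Fin N)) hU hUi le_rfl hRc (hD_avgCoeffY i)
    zero_le_one (B9Thm37CubeCoverCommutatorSizes.sum_abs_avgCoeffY_le_one i) norm_stdBasis_repr_le zero_le_one norm_stdBasis_le_one zero_le_one (blockReadingY i hNf) zero_le_one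
    (hℓ_blockReadingY i hNf) (hℓa_blockReadingY i hNf zero_le_one) (hfib_blockReadingY_matrixUnits i hNf) hunit hBG hρ
    (fun x y E => norm_GpY_parSymY_single_le_of_reg335_affineReading i hG hC0 hC1 hreg (blockReadingY i hNf) (hκ_blockReadingY_affine i hNf) x y E)
    hρ'0 hρ'

end Knit

end Literature.MathematicalPhysics.QuantumFieldTheory.Balaban1983to89.B13SiteReadingNumerals

end
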